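import Summits.BirchSwinnertonDyer.BirchSwinnertonDyer.Theorems.SignedLowerHalvesSmallImageLowerHalfBothSignsRttD2SeqJ3Localization
import Summits.BirchSwinnertonDyer.BirchSwinnertonDyer.Theorems.SignedLowerHalvesSmallImageLowerHalfBothSignsRttD2SeqJ3Transitions
import HarnessLib

/-!
# Route `SignedLowerHalves`, crux L `SmallImageLowerHalfBothSigns` (stmt-BirchSwinnertonDyer-23599), line `rtt_w3` v14 → v15 — E2, row J3
# (Galois side, part β₆): THE STRICT SETS `Str n k` — layer classes LOCALLY TRIVIAL AT THE DEPLETED PLACES `S₀` (all places of `K_{n′}` above `S₀`, all `n′ ≤ n`) —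
# and their stability: corestriction, reduction, conjugation, `𝒪`-scalars, hence the whole `Λ_𝒪 = 𝒪⟦T⟧`-action (the hypotheses `hStr`, `hStrLE` of the J3 assembly p784993)

WIDTH seat `bsd-line-slh-p3-w3` g22 under LEAD `cruxlead-stmt-BirchSwinnertonDyer-23599` g11 (cell `bsd-ssimc`); helper `--supports stmt-BirchSwinnertonDyer-23599`.
ONE DEFINITION WITH BODY (`strictLevel`) + THEOREMS; no named fact, no instance, no `sorry`. HONEST FRAMING (RULING (F1), LEAD KEY 20:11:55Z "cut β6 as `Str n k := ker loc_{n,k}`"):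
`strictLevel S κ θ′ P S₀ n k ≤ cycLayerCohO S κ θ′ P n k 1` is the subgroup of classes `y` with `loc_{n′,w}(conj_δ (cor_{n→n′} y)) = 0` for all `n′ ≤ n`, `w ∈ S₀`, `δ ∈ Γ_K` — i.e. ALL
localisations at the places of `K_{n′}` above `S₀` (the conjugates `loc_w ∘ conj_δ` enumerate them) of all corestrictions vanish. The clause `n′ ≤ n` makes cores-stability TAUTOLOGICAL
(no double-coset formula needed at this stage) and changes nothing at the limit: for a norm-compatible family `(y_n)`, `cor_{n→n′} y_n = y_{n′}`, so `strictCarrier I Str` (p784993) is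
the set of families ALL of whose layers are locally trivial above `S₀` = `ker loc` for junction-1's Iwasawa-level `loc` (LEAD's coupling `Exact ιB loc`). What this file does NOT do:
the semilocal target family `Lloc n k = ⊕_{w′∣S₀} H¹(K_{n,w′}, X_k)` with ITS cores transitions (double-coset Mackey — junction-1's `Hloc`), `hrecL`, `hsolL`. E2, crux L, crux M and
BSD remain OPEN and are proved for NO curve.

* §1 commutations along all `n ≤ n′`: `cycCoresLE_cycLayerConjO`, `cycCoresLE_cycLayerScalarO`, `cycCoresLE_cycLayerRedO`.
* §2 ★ `strictLevel` and `mem_strictLevel_iff`, `locNK_conj_eq_zero_of_mem_strictLevel` (the level-`n` clause); stability: ★ `cycCoresLE_mem_strictLevel`, `cycLayerConjO_mem_strictLevel`,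
  `cycLayerScalarO_mem_strictLevel`, `cycLayerRedO_mem_strictLevel`, `cycRedLE_mem_strictLevel`, ★ `coresLE_redLE_mem_strictLevel` (= `hStrLE`).
* §3 ★★ `smul_mem_strictLevel` (= `hStr`): stability under the `Λ_𝒪`-action of honda's `cycLayerModuleO` (the action is FORCED: `F • y = (trunc F)(ψ_γ) y`, `ψ_γ = conj_γ − 1` locally
  nilpotent — `LocallyNilpotent.smul_eq_aeval_trunc_apply`).
References: [NeukirchSchmidtWingberg2008] I §5, (8.6.*) ; [Kato2004Asterisque] §17.13; [PerrinRiou1987] §4; [Lang1990] Ch. 5 §1; [Kaplansky1954] §19.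
-/

set_option autoImplicit false
set_option linter.dupNamespace false -- D-0017: single-problem summit, the namespace repeats the problem name by design
noncomputable section

open scoped Classical
open NumberField IsDedekindDomain Field CategoryTheory Function Polynomial

namespace Summit.BirchSwinnertonDyer.BirchSwinnertonDyer.Theorems.SmallImageRttD2Seq

open Literature.NumberTheory.EllipticCurves Literature.NumberTheory.GaloisRepresentations
  Literature.NumberTheory.ComplexMultiplication.EllipticUnits.JohnsonLeungKings2011
  Literature.Algebra.Module.LocallyNilpotent
  Summit.BirchSwinnertonDyer.BirchSwinnertonDyer.Theorems.SmallImageRttD2J1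

section Strict

variable {K : Type} [Field K] [NumberField K] {p : ℕ} [Fact p.Prime] (S : Set (PadicAlgCl p)) (κ : ZpExtension K p)
  (θ' : absoluteGaloisGroup K →ₜ* (padicCoeffIntegers S)ˣ) (P : Set (HeightOneSpectrum (𝓞 K)))

/-! ## §1. Commutations along all `n ≤ n′` -/

/-- `cycCoresLE` commutes with the conjugations. [cite: NeukirchSchmidtWingberg2008, I §5 Prop. 1.5.4] -/
theorem cycCoresLE_cycLayerConjO {n n' : ℕ} (h : n ≤ n') (k : ℕ) (γ : absoluteGaloisGroup K) (y : cycLayerCohO S κ θ' P n' k 1) :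
    cycCoresLE S κ θ' P 1 h k (cycLayerConjO S κ θ' P n' k 1 γ y) = cycLayerConjO S κ θ' P n k 1 γ (cycCoresLE S κ θ' P 1 h k y) := by
  induction n', h using Nat.le_induction with
  | base => rw [cycCoresLE_refl, cycCoresLE_refl]
  | succ n' h ih =>
    rw [← cycCoresLE_trans S κ θ' P 1 h (Nat.le_succ n'), cycCoresLE_succ, (cycLayerCoresO_comm S κ θ' P n' k 1).1, ih,
      ← cycCoresLE_succ S κ θ' P 1 n' k y, cycCoresLE_trans]

/-- `cycCoresLE` commutes with the `𝒪`-scalars. [cite: NeukirchSchmidtWingberg2008, I §5 Prop. 1.5.2] -/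
theorem cycCoresLE_cycLayerScalarO {n n' : ℕ} (h : n ≤ n') (k : ℕ) (c : padicCoeffIntegers S) (y : cycLayerCohO S κ θ' P n' k 1) :
    cycCoresLE S κ θ' P 1 h k (cycLayerScalarO S κ θ' P n' k 1 c y) = cycLayerScalarO S κ θ' P n k 1 c (cycCoresLE S κ θ' P 1 h k y) := by
  induction n', h using Nat.le_induction with
  | base => rw [cycCoresLE_refl, cycCoresLE_refl]
  | succ n' h ih =>
    rw [← cycCoresLE_trans S κ θ' P 1 h (Nat.le_succ n'), cycCoresLE_succ, (cycLayerCoresO_comm S κ θ' P n' k 1).2, ih,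
      ← cycCoresLE_succ S κ θ' P 1 n' k y, cycCoresLE_trans]

/-- `cycCoresLE` commutes with the one-step reduction. [cite: Kato2004Asterisque, §8.2 (p. 180)] -/
theorem cycCoresLE_cycLayerRedO {n n' : ℕ} (h : n ≤ n') (k : ℕ) (y : cycLayerCohO S κ θ' P n' (k + 1) 1) :
    cycCoresLE S κ θ' P 1 h k (cycLayerRedO S κ θ' P n' k 1 y) = cycLayerRedO S κ θ' P n k 1 (cycCoresLE S κ θ' P 1 h (k + 1) y) := by
  rw [← cycRedLE_succ, cycCoresLE_cycRedLE, cycRedLE_succ]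

/-! ## §2. The strict sets and their stability -/

variable (S₀ : Set (HeightOneSpectrum (𝓞 K)))

/-- ★ **The strict set `Str n k`**: classes `y ∈ H¹(G_P(K_n), X_k)` with `loc_{n′,w}(conj_δ (cor_{n→n′} y)) = 0` for all `n′ ≤ n`, `w ∈ S₀`, `δ ∈ Γ_K` — all localisations at the
places above the depleted set `S₀` of all corestrictions vanish (RULING (F1): the junction carrier is depleted at `S₀K`). [cite: NeukirchSchmidtWingberg2008, (8.6.2)–(8.6.3)]
[cite: PerrinRiou1987, §4] -/
def strictLevel (n k : ℕ) : AddSubgroup (cycLayerCohO S κ θ' P n k 1) where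
  carrier := {y | ∀ (n' : ℕ) (h : n' ≤ n) (w : HeightOneSpectrum (𝓞 K)), w ∈ S₀ → ∀ δ : absoluteGaloisGroup K,
    locNK S κ θ' P w n' k (cycLayerConjO S κ θ' P n' k 1 δ (cycCoresLE S κ θ' P 1 h k y)) = 0}
  zero_mem' := fun n' h w _ δ ↦ by rw [map_zero, map_zero, map_zero]
  add_mem' := fun {a b} ha hb n' h w hw δ ↦ by rw [map_add, map_add, map_add, ha n' h w hw δ, hb n' h w hw δ, add_zero]
  neg_mem' := fun {a} ha n' h w hw δ ↦ by rw [map_neg, map_neg, map_neg, ha n' h w hw δ, neg_zero]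

/-- Membership in `strictLevel`. [folklore] -/
theorem mem_strictLevel_iff (n k : ℕ) (y : cycLayerCohO S κ θ' P n k 1) :
    y ∈ strictLevel S κ θ' P S₀ n k ↔ ∀ (n' : ℕ) (h : n' ≤ n) (w : HeightOneSpectrum (𝓞 K)), w ∈ S₀ → ∀ δ : absoluteGaloisGroup K,
      locNK S κ θ' P w n' k (cycLayerConjO S κ θ' P n' k 1 δ (cycCoresLE S κ θ' P 1 h k y)) = 0 :=
  Iff.rfl

/-- The level-`n` clause: every localisation of a strict class at a place above `S₀` vanishes. [cite: NeukirchSchmidtWingberg2008, (8.6.2)] -/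
theorem locNK_conj_eq_zero_of_mem_strictLevel {n k : ℕ} {y : cycLayerCohO S κ θ' P n k 1} (hy : y ∈ strictLevel S κ θ' P S₀ n k)
    {w : HeightOneSpectrum (𝓞 K)} (hw : w ∈ S₀) (δ : absoluteGaloisGroup K) :
    locNK S κ θ' P w n k (cycLayerConjO S κ θ' P n k 1 δ y) = 0 := by
  simpa only [cycCoresLE_refl] using hy n le_rfl w hw δ

/-- ★ **`Str` is stable under all corestrictions** (tautological by the clause `n′ ≤ n`). [cite: NeukirchSchmidtWingberg2008, I §5 Prop. 1.5.4] -/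
theorem cycCoresLE_mem_strictLevel {n n' : ℕ} (h : n ≤ n') (k : ℕ) {y : cycLayerCohO S κ θ' P n' k 1} (hy : y ∈ strictLevel S κ θ' P S₀ n' k) :
    cycCoresLE S κ θ' P 1 h k y ∈ strictLevel S κ θ' P S₀ n k := fun n'' h'' w hw δ ↦ by
  rw [cycCoresLE_trans]
  exact hy n'' (h''.trans h) w hw δ

/-- `Str` is stable under honda's one-step corestriction. [cite: NeukirchSchmidtWingberg2008, I §5 Prop. 1.5.4] -/
theorem cycLayerCoresO_mem_strictLevel (n k : ℕ) {y : cycLayerCohO S κ θ' P (n + 1) k 1} (hy : y ∈ strictLevel S κ θ' P S₀ (n + 1) k) :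
    cycLayerCoresO S κ θ' P n k 1 y ∈ strictLevel S κ θ' P S₀ n k := by
  rw [← cycCoresLE_succ]
  exact cycCoresLE_mem_strictLevel S κ θ' P S₀ (Nat.le_succ n) k hy

/-- `Str` is stable under every conjugation `conj_γ`, `γ ∈ Γ_K` (the conjugates `loc_w ∘ conj_δ` are permuted). [cite: NeukirchSchmidtWingberg2008, I §5 Prop. 1.5.3 (iii)] -/
theorem cycLayerConjO_mem_strictLevel (n k : ℕ) (γ : absoluteGaloisGroup K) {y : cycLayerCohO S κ θ' P n k 1} (hy : y ∈ strictLevel S κ θ' P S₀ n k) :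
    cycLayerConjO S κ θ' P n k 1 γ y ∈ strictLevel S κ θ' P S₀ n k := fun n' h w hw δ ↦ by
  rw [cycCoresLE_cycLayerConjO]
  change locNK S κ θ' P w n' k (levelConjO S P θ' (κ.layerSubgroup n') k 1 δ (levelConjO S P θ' (κ.layerSubgroup n') k 1 γ _)) = 0
  rw [levelConjO_levelConjO]
  exact hy n' h w hw (δ * γ)

/-- `Str` is stable under the `𝒪`-scalars. [cite: JohnsonLeungKings2011, §4.1 Def. 4.1] -/
theorem cycLayerScalarO_mem_strictLevel (n k : ℕ) (c : padicCoeffIntegers S) {y : cycLayerCohO S κ θ' P n k 1} (hy : y ∈ strictLevel S κ θ' P S₀ n k) :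
    cycLayerScalarO S κ θ' P n k 1 c y ∈ strictLevel S κ θ' P S₀ n k := fun n' h w hw δ ↦ by
  rw [cycCoresLE_cycLayerScalarO]
  change locNK S κ θ' P w n' k (levelConjO S P θ' (κ.layerSubgroup n') k 1 δ (levelScalarO S P θ' (κ.layerSubgroup n') k 1 c _)) = 0
  rw [← levelScalarO_levelConjO]
  change locNK S κ θ' P w n' k (cycLayerScalarO S κ θ' P n' k 1 c (cycLayerConjO S κ θ' P n' k 1 δ _)) = 0
  rw [locNK_cycLayerScalarO, hy n' h w hw δ]
  exact map_zero _

/-- `Str` is stable under the one-step reduction. [cite: Kato2004Asterisque, §8.2 (p. 180)] -/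
theorem cycLayerRedO_mem_strictLevel (n k : ℕ) {y : cycLayerCohO S κ θ' P n (k + 1) 1} (hy : y ∈ strictLevel S κ θ' P S₀ n (k + 1)) :
    cycLayerRedO S κ θ' P n k 1 y ∈ strictLevel S κ θ' P S₀ n k := fun n' h w hw δ ↦ by
  rw [cycCoresLE_cycLayerRedO, ← cycLayerRedO_cycLayerConjO, locNK_cycLayerRedO, hy n' h w hw δ]
  exact map_zero _

/-- `Str` is stable under all reductions `cycRedLE`. [cite: Kato2004Asterisque, §8.2 (p. 180)] -/
theorem cycRedLE_mem_strictLevel (n : ℕ) {k k' : ℕ} (h : k ≤ k') {y : cycLayerCohO S κ θ' P n k' 1} (hy : y ∈ strictLevel S κ θ' P S₀ n k') :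
    cycRedLE S κ θ' P 1 n h y ∈ strictLevel S κ θ' P S₀ n k := by
  induction k', h using Nat.le_induction with
  | base => rwa [cycRedLE_refl]
  | succ k' h ih => 
    rw [← cycRedLE_trans S κ θ' P 1 n h (Nat.le_succ k'), cycRedLE_succ]
    exact ih (cycLayerRedO_mem_strictLevel S κ θ' P S₀ n k' hy)

/-- ★ **`hStrLE`**: `Str` is closed under the transitions `coresLE ∘ redLE` of the inhabitant `layerPairingOf` (p789748). [cite: NeukirchSchmidtWingberg2008, I §5] -/
theorem coresLE_redLE_mem_strictLevel {n n' : ℕ} (hn : n ≤ n') {k k' : ℕ} (hk : k ≤ k') {y : cycLayerCohO S κ θ' P n' k' 1}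
    (hy : y ∈ strictLevel S κ θ' P S₀ n' k') :
    cycCoresLE S κ θ' P 1 hn k (cycRedLE S κ θ' P 1 n' hk y) ∈ strictLevel S κ θ' P S₀ n k :=
  cycCoresLE_mem_strictLevel S κ θ' P S₀ hn k (cycRedLE_mem_strictLevel S κ θ' P S₀ n' hk hy)

/-! ## §3. Stability under the `Λ_𝒪`-action -/

/-- `Str` is stable under `ψ_γ = conj_γ − 1` and its powers. [cite: JohnsonLeungKings2011, §4.2] -/
theorem cycLayerPsiO_pow_mem_strictLevel (γ : absoluteGaloisGroup K) (n k m : ℕ) {y : cycLayerCohO S κ θ' P n k 1} (hy : y ∈ strictLevel S κ θ' P S₀ n k) :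
    (letI := levelModuleO S P θ' (κ.layerSubgroup n) k 1
     (cycLayerPsiO S κ θ' P n k 1 γ ^ m) y) ∈ strictLevel S κ θ' P S₀ n k := by
  letI := levelModuleO S P θ' (κ.layerSubgroup n) k 1
  induction m with
  | zero => simpa using hy
  | succ m ih =>
    rw [pow_succ', Module.End.mul_apply, cycLayerPsiO_apply]
    exact sub_mem (cycLayerConjO_mem_strictLevel S κ θ' P S₀ n k γ ih) ih

/-- `Str` is stable under every polynomial in `ψ_γ` with coefficients in `𝒪`. [cite: Kaplansky1954, §19] -/
theorem aeval_cycLayerPsiO_mem_strictLevel (γ : absoluteGaloisGroup K) (n k : ℕ) (Q : (padicCoeffIntegers S)[X]) {y : cycLayerCohO S κ θ' P n k 1}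
    (hy : y ∈ strictLevel S κ θ' P S₀ n k) :
    (letI := levelModuleO S P θ' (κ.layerSubgroup n) k 1
     aeval (cycLayerPsiO S κ θ' P n k 1 γ) Q y) ∈ strictLevel S κ θ' P S₀ n k := by
  letI := levelModuleO S P θ' (κ.layerSubgroup n) k 1
  induction Q using Polynomial.induction_on' with
  | add p q hp hq => rw [map_add, LinearMap.add_apply]; exact add_mem hp hq
  | monomial m a =>
    rw [aeval_monomial, Module.End.mul_apply, Module.algebraMap_end_apply, levelModuleO_smul]
    exact cycLayerScalarO_mem_strictLevel S κ θ' P S₀ n k a (cycLayerPsiO_pow_mem_strictLevel S κ θ' P S₀ γ n k m hy)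

/-- ★★ **`hStr`: `Str` is a `Λ_𝒪 = 𝒪⟦T⟧`-submodule** for honda's (forced) layer action `cycLayerModuleO` at the generator `γ`: `F • y = (trunc F)(ψ_γ) y`.
[cite: JohnsonLeungKings2011, §4.2 (arXiv p0012:L109–112)] [cite: Kaplansky1954, §19 Theorem 31] [cite: Lang1990, Ch. 5 §1] -/
theorem smul_mem_strictLevel (γ : absoluteGaloisGroup K) (n k : ℕ) (F : IwasawaAlgebraO S) {y : cycLayerCohO S κ θ' P n k 1} (hy : y ∈ strictLevel S κ θ' P S₀ n k) :
    (letI := cycLayerModuleO S κ γ θ' P (show 1 ≤ 2 by norm_num) n k; F • y) ∈ strictLevel S κ θ' P S₀ n k := by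
  letI := levelModuleO S P θ' (κ.layerSubgroup n) k 1
  letI := cycLayerModuleO S κ γ θ' P (show 1 ≤ 2 by norm_num) n k
  obtain ⟨hC, hX⟩ := cycLayerModuleO_spec S κ γ θ' P (show 1 ≤ 2 by norm_num) n k
  obtain ⟨m, hm⟩ := cycLayerPsiO_locallyNilpotent S κ γ θ' P n k (show 1 ≤ 2 by norm_num) y
  rw [smul_eq_aeval_trunc_apply hC hX hm F]
  exact aeval_cycLayerPsiO_mem_strictLevel S κ θ' P S₀ γ n k _ hy

end Strict

end Summit.BirchSwinnertonDyer.BirchSwinnertonDyer.Theorems.SmallImageRttD2Seq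

end
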